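import Summits.BirchSwinnertonDyer.Rank1Residual.GaloisImage.ThreeTorsionPairValuesSubgroup
import HarnessLib

/-!
# The Δ-cube law of `3`-congruences: symplectic `⇒ Δ_E / Δ_{E′} ∈ K^{×3}`,
# anti-symplectic `⇒ Δ_E Δ_{E′} ∈ K^{×3}`
# (cell `b2b-bsdres`, team n1011, seat p02 gen 10 — row T-E3SYMP, file F3b; TOOL)

HONEST FRAMING (cell `b2b-bsdres`, run/shared/lean/b2b/bsd-rank1-residual/, verbatim in every
file): the goal of the cell is to DELETE the COMBINATION-SHAPED residual classes of the
Birch–Swinnerton-Dyer formula for ALL analytic-rank `≤ 1` elliptic curves over `ℚ` — "full BSD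
formula for every rank `≤ 1` curve in class `C`" assembled STRICTLY from published theorems — so
that the rank-`≤ 1` remainder becomes exactly the CONSTRUCTION-SHAPED classes, which are TYPED
(missing-input `Prop`s), NOT attempted. This is not "finishing BSD". Team n1011 (N10 / N11):
research route; no claim beyond the stated classes; labels UNCHANGED; nothing is booked. Theorems
only (no definition, no named fact).

## What this file proves

`W, W′` elliptic curves over a field `K` of characteristic `0` (ANY models), `K̄ = AlgebraicClosure K`,
`E[3] = geomTorsion W 3`, `E′[3] = geomTorsion W′ 3`, `θ : E′[3] ≃+ E[3]` an additive isomorphism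
COMMUTING WITH `Γ_K` (`hθ`), and pairings `e` on `E[3]`, `e′` on `E′[3]` NORMALISED by the cube-root
formula of files F1/F2: `e S T · B₁(S,T) = B₂(S,T)` on every basis (hypotheses `hN`, `hN'`; the
pairings of `exists_cubeRootWeilPairing` satisfy them).  With `c(P,Q) := B₁(θP,θQ) / B₁′(P,Q)`
(resp. `· B₁′(P,Q)`):

* `exists_Δ_eq_cube_mul_Δ_of_symplectic` — if `e (θS) (θT) = e′ S T` for all `S, T` then
  **`W.Δ = c³ · W′.Δ` for some `c ∈ K`**;
* `exists_Δ_mul_Δ_eq_cube_of_antisymplectic` — if `e (θS) (θT) = (e′ S T)⁻¹` for all `S, T` then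
  **`W.Δ · W′.Δ = c³` for some `c ∈ K`**;
* `Δ_eq_cube_mul_or_mul_eq_cube_of_threeCongruent` — for EVERY `Γ_K`-equivariant `θ : E′[3] ≃+ E[3]`:
  `(∃ c : K, W.Δ = c³ W′.Δ) ∨ (∃ c : K, W.Δ W′.Δ = c³)` (the cube-root pairings of file F2b and the
  dichotomy of file F3a) — r1 ROUTE-1 §43's instrument (D) ("Fisher's discriminant law", P43-h) as a
  theorem for every `3`-congruence, not only Hesse-certified ones;
* `not_threeCongruent_of_forall_ne_cube` — the NO-GO: if neither `Δ/Δ′` nor `ΔΔ′` is a cube in `K`,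
  `E` and `E′` are not `3`-congruent over `K`;
* `symplectic_of_forall_mul_ne_cube`, `antisymplectic_of_forall_ne_cube_mul` — if `ΔΔ′ ∉ K³` every
  `Γ_K`-equivariant `θ` is symplectic for the cube-root pairings; if `Δ ∉ Δ′K³` every one is
  anti-symplectic (r1 §43.3: "`det θ₀ = +1 ⟺ Δ_E/Δ_{E′} ∈ ℚ₃^{×3}`", here over any `K`).

Mechanism: on a basis the pair values are the cube roots of `Δ` (F1), `θ` carries bases of `E′[3]`
to bases of `E[3]`, and `c(P,Q)` is invariant under the moves `(Q,P)`, `(−P,Q)`, `(P,−Q)` (both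
`B₁`'s unchanged) and `(P,P±Q)` (`B₁ ↦ B₂ = e·B₁`, `B₁ ↦ B₃ = e²·B₁` on BOTH curves, and
`e(θP,θQ) = e′(P,Q)^{±1}`), hence constant (F3a `const_of_moves`); so `σ c = c(σP, σQ) = c` for
`σ ∈ Γ_K` and `c ∈ K` (`K̄/K` Galois); finally `c³ = Δ/Δ′` (resp. `ΔΔ′`).  Nothing is cited as an
input.  Not claimed: anything about the divisor-theoretic Weil pairing; any `d₃` verdict.  Related tree
results in other parametrisations (not used here): `ThreeTorsionRadicalsProofs.pair_mul_add_pair_mul_eq`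
(`_one`, `_two`) — the pair values of the RADICAL abscissae are `b₄ − ζᵏ∛Δ`; `GaloisImage/
ThreeTorsionCubeDiscriminant.lean` — `Δ ∉ K³ ⇒ 3 ∣ #ρ̄_{E,3}(Γ_K)`; `Fisher2012/HessePencilThreeClosedForms`
(`Δ_hessePencil3`: `Δ(E_{λ,μ}) = Δ(E)·𝔇(λ,μ)³`, the Hesse-family instance of the symplectic case).
References (context): Fisher, Proc. LMS 104 (2012) Rem. 8.6, §13; Serre 1972 §5.3;
Freitas–Kraus, Mem. AMS 1361.
-/

noncomputable section

open scoped Classical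

open WeierstrassCurve WeierstrassCurve.Affine.Point Literature.NumberTheory.EllipticCurves

namespace Summit.BirchSwinnertonDyer.Rank1Residual.GaloisImage.CubeRootPairing

universe u

variable {K : Type u} [Field K] [CharZero K]


/-! ### The Δ-cube law -/

section CubeLaw

variable (W W' : WeierstrassCurve K) [W.IsElliptic] [W'.IsElliptic]

/-- **SYMPLECTIC FOR THE CUBE-ROOT PAIRINGS ⇒ `Δ_E = c³ Δ_{E′}`.** For `e` on `E[3]` and `e′` on
`E′[3]` normalised by the cube-root formula (`hN`, `hN'`: `e S T · B₁ = B₂` on every basis) and a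
`Γ_K`-equivariant additive isomorphism `θ : E′[3] ≃ E[3]` with `e (θS) (θT) = e′ S T` for all `S, T`
(symplectic FOR THESE PAIRINGS — no identification with the divisor-theoretic Weil pairing is
claimed), there is `c ∈ K` with `W.Δ = c³ · W′.Δ`.  (Instrument (D) of r1 ROUTE-1 §43: "direct
⇒ `Δ_{E′} ∈ Δ_E · K^{×3}`".) [folklore] -/
theorem exists_Δ_eq_cube_mul_Δ_of_symplectic
    {e : geomTorsion W 3 → geomTorsion W 3 → AlgebraicClosure K}
    {e' : geomTorsion W' 3 → geomTorsion W' 3 → AlgebraicClosure K}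
    (hN : ∀ S T : geomTorsion W 3, (S : geomPoints W) ≠ 0 → (T : geomPoints W) ≠ 0 →
        ((S + T : geomTorsion W 3) : geomPoints W) ≠ 0 →
        ((S - T : geomTorsion W 3) : geomPoints W) ≠ 0 →
        e S T * ((W.baseChange (AlgebraicClosure K)).b₄ -
          3 * (xOf (W := W.baseChange (AlgebraicClosure K)) ((S : geomTorsion W 3) : geomPoints W) *
              xOf (W := W.baseChange (AlgebraicClosure K)) ((T : geomTorsion W 3) : geomPoints W) +
            xOf (W := W.baseChange (AlgebraicClosure K)) ((S + T : geomTorsion W 3) : geomPoints W) *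
              xOf (W := W.baseChange (AlgebraicClosure K)) ((S - T : geomTorsion W 3) : geomPoints W))) =
          ((W.baseChange (AlgebraicClosure K)).b₄ -
          3 * (xOf (W := W.baseChange (AlgebraicClosure K)) ((S : geomTorsion W 3) : geomPoints W) *
              xOf (W := W.baseChange (AlgebraicClosure K)) ((S + T : geomTorsion W 3) : geomPoints W) +
            xOf (W := W.baseChange (AlgebraicClosure K)) ((T : geomTorsion W 3) : geomPoints W) *
              xOf (W := W.baseChange (AlgebraicClosure K)) ((S - T : geomTorsion W 3) : geomPoints W))))
    (hN' : ∀ S T : geomTorsion W' 3, (S : geomPoints W') ≠ 0 → (T : geomPoints W') ≠ 0 →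
        ((S + T : geomTorsion W' 3) : geomPoints W') ≠ 0 →
        ((S - T : geomTorsion W' 3) : geomPoints W') ≠ 0 →
        e' S T * ((W'.baseChange (AlgebraicClosure K)).b₄ -
          3 * (xOf (W := W'.baseChange (AlgebraicClosure K)) ((S : geomTorsion W' 3) : geomPoints W') *
              xOf (W := W'.baseChange (AlgebraicClosure K)) ((T : geomTorsion W' 3) : geomPoints W') +
            xOf (W := W'.baseChange (AlgebraicClosure K)) ((S + T : geomTorsion W' 3) : geomPoints W') *
              xOf (W := W'.baseChange (AlgebraicClosure K)) ((S - T : geomTorsion W' 3) : geomPoints W'))) =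
          ((W'.baseChange (AlgebraicClosure K)).b₄ -
          3 * (xOf (W := W'.baseChange (AlgebraicClosure K)) ((S : geomTorsion W' 3) : geomPoints W') *
              xOf (W := W'.baseChange (AlgebraicClosure K)) ((S + T : geomTorsion W' 3) : geomPoints W') +
            xOf (W := W'.baseChange (AlgebraicClosure K)) ((T : geomTorsion W' 3) : geomPoints W') *
              xOf (W := W'.baseChange (AlgebraicClosure K)) ((S - T : geomTorsion W' 3) : geomPoints W'))))
    (θ : geomTorsion W' 3 ≃+ geomTorsion W 3)
    (hθ : ∀ (σ : Field.absoluteGaloisGroup K) (P : geomTorsion W' 3), θ (σ • P) = σ • θ P)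
    (hsym : ∀ S T, e (θ S) (θ T) = e' S T) :
    ∃ c : K, W.Δ = c ^ 3 * W'.Δ := by
  obtain ⟨S₀, T₀, h₁, h₂, h₃, h₄⟩ := exists_geomTorsion_three_basis W'
  -- the invariant `c(P,Q) := B₁(θP,θQ) / B₁′(P,Q)`
  set c : geomTorsion W' 3 → geomTorsion W' 3 → AlgebraicClosure K := fun P Q => ((W.baseChange (AlgebraicClosure K)).b₄ -
          3 * (xOf (W := W.baseChange (AlgebraicClosure K)) ((θ P : geomTorsion W 3) : geomPoints W) *
              xOf (W := W.baseChange (AlgebraicClosure K)) ((θ Q : geomTorsion W 3) : geomPoints W) +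
            xOf (W := W.baseChange (AlgebraicClosure K)) (((θ P) + (θ Q) : geomTorsion W 3) : geomPoints W) *
              xOf (W := W.baseChange (AlgebraicClosure K)) (((θ P) - (θ Q) : geomTorsion W 3) : geomPoints W))) / ((W'.baseChange (AlgebraicClosure K)).b₄ -
          3 * (xOf (W := W'.baseChange (AlgebraicClosure K)) ((P : geomTorsion W' 3) : geomPoints W') *
              xOf (W := W'.baseChange (AlgebraicClosure K)) ((Q : geomTorsion W' 3) : geomPoints W') +
            xOf (W := W'.baseChange (AlgebraicClosure K)) ((P + Q : geomTorsion W' 3) : geomPoints W') *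
              xOf (W := W'.baseChange (AlgebraicClosure K)) ((P - Q : geomTorsion W' 3) : geomPoints W')))
    with hc
  have hcPQ : ∀ P Q, c P Q = ((W.baseChange (AlgebraicClosure K)).b₄ -
          3 * (xOf (W := W.baseChange (AlgebraicClosure K)) ((θ P : geomTorsion W 3) : geomPoints W) *
              xOf (W := W.baseChange (AlgebraicClosure K)) ((θ Q : geomTorsion W 3) : geomPoints W) +
            xOf (W := W.baseChange (AlgebraicClosure K)) (((θ P) + (θ Q) : geomTorsion W 3) : geomPoints W) *
              xOf (W := W.baseChange (AlgebraicClosure K)) (((θ P) - (θ Q) : geomTorsion W 3) : geomPoints W))) / ((W'.baseChange (AlgebraicClosure K)).b₄ -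
          3 * (xOf (W := W'.baseChange (AlgebraicClosure K)) ((P : geomTorsion W' 3) : geomPoints W') *
              xOf (W := W'.baseChange (AlgebraicClosure K)) ((Q : geomTorsion W' 3) : geomPoints W') +
            xOf (W := W'.baseChange (AlgebraicClosure K)) ((P + Q : geomTorsion W' 3) : geomPoints W') *
              xOf (W := W'.baseChange (AlgebraicClosure K)) ((P - Q : geomTorsion W' 3) : geomPoints W'))) := fun P Q => rfl
  have I1 : ∀ P Q : geomTorsion W' 3, P ≠ 0 → Q ≠ 0 → P + Q ≠ 0 → P - Q ≠ 0 → c Q P = c P Q :=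
    fun P Q _ _ _ _ => by rw [hcPQ, hcPQ, pairValue_swap W (θ P) (θ Q), pairValue_swap W' P Q]
  have I2 : ∀ P Q : geomTorsion W' 3, P ≠ 0 → Q ≠ 0 → P + Q ≠ 0 → P - Q ≠ 0 → c (-P) Q = c P Q :=
    fun P Q _ _ _ _ => by
      rw [hcPQ, hcPQ, map_neg, pairValue_negLeft W (θ P) (θ Q), pairValue_negLeft W' P Q]
  have I3 : ∀ P Q : geomTorsion W' 3, P ≠ 0 → Q ≠ 0 → P + Q ≠ 0 → P - Q ≠ 0 → c P (-Q) = c P Q :=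
    fun P Q _ _ _ _ => by
      rw [hcPQ, hcPQ, map_neg, pairValue_negRight W (θ P) (θ Q), pairValue_negRight W' P Q]
  have I4 : ∀ P Q : geomTorsion W' 3, P ≠ 0 → Q ≠ 0 → P + Q ≠ 0 → P - Q ≠ 0 →
      c P (P + Q) = c P Q := fun P Q hP hQ hPQ hPQ' => by
    obtain ⟨g₁, g₂, g₃, g₄⟩ := basis_map W W' θ hP hQ hPQ hPQ'
    obtain ⟨-, f2, -, -, -⟩ := pairValue_facts W hN g₁ g₂ g₃ g₄
    obtain ⟨-, f2', -, fe', -⟩ := pairValue_facts W' hN' hP hQ hPQ hPQ'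
    rw [hcPQ, hcPQ, map_add, pairValue_addRight W (θ P) (θ Q), pairValue_addRight W' P Q, f2, f2',
      hsym, mul_div_mul_left _ _ fe']
  have I5 : ∀ P Q : geomTorsion W' 3, P ≠ 0 → Q ≠ 0 → P + Q ≠ 0 → P - Q ≠ 0 →
      c P (P - Q) = c P Q := fun P Q hP hQ hPQ hPQ' => by
    obtain ⟨g₁, g₂, g₃, g₄⟩ := basis_map W W' θ hP hQ hPQ hPQ'
    obtain ⟨-, -, f3, -, -⟩ := pairValue_facts W hN g₁ g₂ g₃ g₄
    obtain ⟨-, -, f3', fe', -⟩ := pairValue_facts W' hN' hP hQ hPQ hPQ'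
    rw [hcPQ, hcPQ, map_sub, pairValue_subRight W (θ P) (θ Q), pairValue_subRight W' P Q, f3, f3',
      hsym, mul_div_mul_left _ _ (pow_ne_zero 2 fe')]
  have hσ : ∀ (σ : Field.absoluteGaloisGroup K) (P Q : geomTorsion W' 3), P ≠ 0 → Q ≠ 0 →
      P + Q ≠ 0 → P - Q ≠ 0 → σ • c P Q = c (σ • P) (σ • Q) := fun σ P Q _ _ _ _ => by
    rw [hcPQ, hcPQ, Field.absoluteGaloisGroup.smul_def, map_div₀,
      ← Field.absoluteGaloisGroup.smul_def, ← Field.absoluteGaloisGroup.smul_def,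
      smul_pairValue W σ (θ P) (θ Q), smul_pairValue W' σ P Q, ← hθ, ← hθ]
  obtain ⟨k, hk⟩ := exists_algebraMap_eq_of_moves W' c I1 I2 I3 I4 I5 hσ h₁ h₂ h₃ h₄
  -- the cube of the invariant
  obtain ⟨g₁, g₂, g₃, g₄⟩ := basis_map W W' θ h₁ h₂ h₃ h₄
  obtain ⟨-, -, -, -, c3⟩ := pairValue_facts W hN g₁ g₂ g₃ g₄
  obtain ⟨b1', -, -, -, c3'⟩ := pairValue_facts W' hN' h₁ h₂ h₃ h₄
  refine ⟨k, (algebraMap K (AlgebraicClosure K)).injective ?_⟩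
  have hΔ : algebraMap K (AlgebraicClosure K) W.Δ = (W.baseChange (AlgebraicClosure K)).Δ := by
    rw [WeierstrassCurve.baseChange, WeierstrassCurve.map_Δ]
  have hΔ' : algebraMap K (AlgebraicClosure K) W'.Δ = (W'.baseChange (AlgebraicClosure K)).Δ := by
    rw [WeierstrassCurve.baseChange, WeierstrassCurve.map_Δ]
  rw [map_mul, map_pow, hk, hcPQ, hΔ, hΔ', ← c3, ← c3', div_pow,
    div_mul_cancel₀ _ (pow_ne_zero 3 b1')]

/-- **ANTI-SYMPLECTIC FOR THE CUBE-ROOT PAIRINGS ⇒ `Δ_E Δ_{E′} = c³`.** Same setting with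
`e (θS) (θT) = (e′ S T)⁻¹` for all `S, T`: there is `c ∈ K` with `W.Δ · W′.Δ = c³`.  (r1 §43 (D):
"reverse ⇒ `Δ_EΔ_{E′} ∈ K^{×3}`".) [folklore] -/
theorem exists_Δ_mul_Δ_eq_cube_of_antisymplectic
    {e : geomTorsion W 3 → geomTorsion W 3 → AlgebraicClosure K}
    {e' : geomTorsion W' 3 → geomTorsion W' 3 → AlgebraicClosure K}
    (hN : ∀ S T : geomTorsion W 3, (S : geomPoints W) ≠ 0 → (T : geomPoints W) ≠ 0 →
        ((S + T : geomTorsion W 3) : geomPoints W) ≠ 0 →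
        ((S - T : geomTorsion W 3) : geomPoints W) ≠ 0 →
        e S T * ((W.baseChange (AlgebraicClosure K)).b₄ -
          3 * (xOf (W := W.baseChange (AlgebraicClosure K)) ((S : geomTorsion W 3) : geomPoints W) *
              xOf (W := W.baseChange (AlgebraicClosure K)) ((T : geomTorsion W 3) : geomPoints W) +
            xOf (W := W.baseChange (AlgebraicClosure K)) ((S + T : geomTorsion W 3) : geomPoints W) *
              xOf (W := W.baseChange (AlgebraicClosure K)) ((S - T : geomTorsion W 3) : geomPoints W))) =
          ((W.baseChange (AlgebraicClosure K)).b₄ -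
          3 * (xOf (W := W.baseChange (AlgebraicClosure K)) ((S : geomTorsion W 3) : geomPoints W) *
              xOf (W := W.baseChange (AlgebraicClosure K)) ((S + T : geomTorsion W 3) : geomPoints W) +
            xOf (W := W.baseChange (AlgebraicClosure K)) ((T : geomTorsion W 3) : geomPoints W) *
              xOf (W := W.baseChange (AlgebraicClosure K)) ((S - T : geomTorsion W 3) : geomPoints W))))
    (hN' : ∀ S T : geomTorsion W' 3, (S : geomPoints W') ≠ 0 → (T : geomPoints W') ≠ 0 →
        ((S + T : geomTorsion W' 3) : geomPoints W') ≠ 0 →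
        ((S - T : geomTorsion W' 3) : geomPoints W') ≠ 0 →
        e' S T * ((W'.baseChange (AlgebraicClosure K)).b₄ -
          3 * (xOf (W := W'.baseChange (AlgebraicClosure K)) ((S : geomTorsion W' 3) : geomPoints W') *
              xOf (W := W'.baseChange (AlgebraicClosure K)) ((T : geomTorsion W' 3) : geomPoints W') +
            xOf (W := W'.baseChange (AlgebraicClosure K)) ((S + T : geomTorsion W' 3) : geomPoints W') *
              xOf (W := W'.baseChange (AlgebraicClosure K)) ((S - T : geomTorsion W' 3) : geomPoints W'))) =
          ((W'.baseChange (AlgebraicClosure K)).b₄ -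
          3 * (xOf (W := W'.baseChange (AlgebraicClosure K)) ((S : geomTorsion W' 3) : geomPoints W') *
              xOf (W := W'.baseChange (AlgebraicClosure K)) ((S + T : geomTorsion W' 3) : geomPoints W') +
            xOf (W := W'.baseChange (AlgebraicClosure K)) ((T : geomTorsion W' 3) : geomPoints W') *
              xOf (W := W'.baseChange (AlgebraicClosure K)) ((S - T : geomTorsion W' 3) : geomPoints W'))))
    (θ : geomTorsion W' 3 ≃+ geomTorsion W 3)
    (hθ : ∀ (σ : Field.absoluteGaloisGroup K) (P : geomTorsion W' 3), θ (σ • P) = σ • θ P)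
    (hanti : ∀ S T, e (θ S) (θ T) = (e' S T)⁻¹) :
    ∃ c : K, W.Δ * W'.Δ = c ^ 3 := by
  obtain ⟨S₀, T₀, h₁, h₂, h₃, h₄⟩ := exists_geomTorsion_three_basis W'
  -- the invariant `c(P,Q) := B₁(θP,θQ) · B₁′(P,Q)`
  set c : geomTorsion W' 3 → geomTorsion W' 3 → AlgebraicClosure K := fun P Q => ((W.baseChange (AlgebraicClosure K)).b₄ -
          3 * (xOf (W := W.baseChange (AlgebraicClosure K)) ((θ P : geomTorsion W 3) : geomPoints W) *
              xOf (W := W.baseChange (AlgebraicClosure K)) ((θ Q : geomTorsion W 3) : geomPoints W) +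
            xOf (W := W.baseChange (AlgebraicClosure K)) (((θ P) + (θ Q) : geomTorsion W 3) : geomPoints W) *
              xOf (W := W.baseChange (AlgebraicClosure K)) (((θ P) - (θ Q) : geomTorsion W 3) : geomPoints W))) * ((W'.baseChange (AlgebraicClosure K)).b₄ -
          3 * (xOf (W := W'.baseChange (AlgebraicClosure K)) ((P : geomTorsion W' 3) : geomPoints W') *
              xOf (W := W'.baseChange (AlgebraicClosure K)) ((Q : geomTorsion W' 3) : geomPoints W') +
            xOf (W := W'.baseChange (AlgebraicClosure K)) ((P + Q : geomTorsion W' 3) : geomPoints W') *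
              xOf (W := W'.baseChange (AlgebraicClosure K)) ((P - Q : geomTorsion W' 3) : geomPoints W')))
    with hc
  have hcPQ : ∀ P Q, c P Q = ((W.baseChange (AlgebraicClosure K)).b₄ -
          3 * (xOf (W := W.baseChange (AlgebraicClosure K)) ((θ P : geomTorsion W 3) : geomPoints W) *
              xOf (W := W.baseChange (AlgebraicClosure K)) ((θ Q : geomTorsion W 3) : geomPoints W) +
            xOf (W := W.baseChange (AlgebraicClosure K)) (((θ P) + (θ Q) : geomTorsion W 3) : geomPoints W) *
              xOf (W := W.baseChange (AlgebraicClosure K)) (((θ P) - (θ Q) : geomTorsion W 3) : geomPoints W))) * ((W'.baseChange (AlgebraicClosure K)).b₄ -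
          3 * (xOf (W := W'.baseChange (AlgebraicClosure K)) ((P : geomTorsion W' 3) : geomPoints W') *
              xOf (W := W'.baseChange (AlgebraicClosure K)) ((Q : geomTorsion W' 3) : geomPoints W') +
            xOf (W := W'.baseChange (AlgebraicClosure K)) ((P + Q : geomTorsion W' 3) : geomPoints W') *
              xOf (W := W'.baseChange (AlgebraicClosure K)) ((P - Q : geomTorsion W' 3) : geomPoints W'))) := fun P Q => rfl
  have I1 : ∀ P Q : geomTorsion W' 3, P ≠ 0 → Q ≠ 0 → P + Q ≠ 0 → P - Q ≠ 0 → c Q P = c P Q :=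
    fun P Q _ _ _ _ => by rw [hcPQ, hcPQ, pairValue_swap W (θ P) (θ Q), pairValue_swap W' P Q]
  have I2 : ∀ P Q : geomTorsion W' 3, P ≠ 0 → Q ≠ 0 → P + Q ≠ 0 → P - Q ≠ 0 → c (-P) Q = c P Q :=
    fun P Q _ _ _ _ => by
      rw [hcPQ, hcPQ, map_neg, pairValue_negLeft W (θ P) (θ Q), pairValue_negLeft W' P Q]
  have I3 : ∀ P Q : geomTorsion W' 3, P ≠ 0 → Q ≠ 0 → P + Q ≠ 0 → P - Q ≠ 0 → c P (-Q) = c P Q :=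
    fun P Q _ _ _ _ => by
      rw [hcPQ, hcPQ, map_neg, pairValue_negRight W (θ P) (θ Q), pairValue_negRight W' P Q]
  have I4 : ∀ P Q : geomTorsion W' 3, P ≠ 0 → Q ≠ 0 → P + Q ≠ 0 → P - Q ≠ 0 →
      c P (P + Q) = c P Q := fun P Q hP hQ hPQ hPQ' => by
    obtain ⟨g₁, g₂, g₃, g₄⟩ := basis_map W W' θ hP hQ hPQ hPQ'
    obtain ⟨-, f2, -, -, -⟩ := pairValue_facts W hN g₁ g₂ g₃ g₄
    obtain ⟨-, f2', -, fe', -⟩ := pairValue_facts W' hN' hP hQ hPQ hPQ'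
    rw [hcPQ, hcPQ, map_add, pairValue_addRight W (θ P) (θ Q), pairValue_addRight W' P Q, f2, f2',
      hanti, mul_mul_mul_comm, inv_mul_cancel₀ fe', one_mul]
  have I5 : ∀ P Q : geomTorsion W' 3, P ≠ 0 → Q ≠ 0 → P + Q ≠ 0 → P - Q ≠ 0 →
      c P (P - Q) = c P Q := fun P Q hP hQ hPQ hPQ' => by
    obtain ⟨g₁, g₂, g₃, g₄⟩ := basis_map W W' θ hP hQ hPQ hPQ'
    obtain ⟨-, -, f3, -, -⟩ := pairValue_facts W hN g₁ g₂ g₃ g₄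
    obtain ⟨-, -, f3', fe', -⟩ := pairValue_facts W' hN' hP hQ hPQ hPQ'
    rw [hcPQ, hcPQ, map_sub, pairValue_subRight W (θ P) (θ Q), pairValue_subRight W' P Q, f3, f3',
      hanti, mul_mul_mul_comm, inv_pow, inv_mul_cancel₀ (pow_ne_zero 2 fe'), one_mul]
  have hσ : ∀ (σ : Field.absoluteGaloisGroup K) (P Q : geomTorsion W' 3), P ≠ 0 → Q ≠ 0 →
      P + Q ≠ 0 → P - Q ≠ 0 → σ • c P Q = c (σ • P) (σ • Q) := fun σ P Q _ _ _ _ => by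
    rw [hcPQ, hcPQ, smul_mul', smul_pairValue W σ (θ P) (θ Q), smul_pairValue W' σ P Q, ← hθ, ← hθ]
  obtain ⟨k, hk⟩ := exists_algebraMap_eq_of_moves W' c I1 I2 I3 I4 I5 hσ h₁ h₂ h₃ h₄
  obtain ⟨g₁, g₂, g₃, g₄⟩ := basis_map W W' θ h₁ h₂ h₃ h₄
  obtain ⟨-, -, -, -, c3⟩ := pairValue_facts W hN g₁ g₂ g₃ g₄
  obtain ⟨-, -, -, -, c3'⟩ := pairValue_facts W' hN' h₁ h₂ h₃ h₄
  refine ⟨k, (algebraMap K (AlgebraicClosure K)).injective ?_⟩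
  have hΔ : algebraMap K (AlgebraicClosure K) W.Δ = (W.baseChange (AlgebraicClosure K)).Δ := by
    rw [WeierstrassCurve.baseChange, WeierstrassCurve.map_Δ]
  have hΔ' : algebraMap K (AlgebraicClosure K) W'.Δ = (W'.baseChange (AlgebraicClosure K)).Δ := by
    rw [WeierstrassCurve.baseChange, WeierstrassCurve.map_Δ]
  rw [map_mul, map_pow, hk, hcPQ, hΔ, hΔ', ← c3, ← c3', mul_pow]

/-- **THE Δ-CUBE LAW OF `3`-CONGRUENCES.** If `E′[3] ≅ E[3]` as `Γ_K`-modules (any additive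
isomorphism commuting with `Γ_K`), then `Δ_E = c³Δ_{E′}` or `Δ_EΔ_{E′} = c³` for some `c ∈ K`
(cube-root pairings of file F2b + dichotomy of file F3a + the two theorems above).  r1 ROUTE-1 §43.2
instrument (D) ("Fisher's discriminant law", P43-h 285/285) for EVERY `3`-congruence.
[cite: Fisher2012Hessian, Remark 8.6 and §13 (discriminants in the Hesse families)] -/
theorem Δ_eq_cube_mul_or_mul_eq_cube_of_threeCongruent (θ : geomTorsion W' 3 ≃+ geomTorsion W 3)
    (hθ : ∀ (σ : Field.absoluteGaloisGroup K) (P : geomTorsion W' 3), θ (σ • P) = σ • θ P) :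
    (∃ c : K, W.Δ = c ^ 3 * W'.Δ) ∨ (∃ c : K, W.Δ * W'.Δ = c ^ 3) := by
  obtain ⟨e, he3, hel, her, healt, hend, -, hN⟩ := exists_cubeRootWeilPairing W
  obtain ⟨e', he'3, he'l, he'r, he'alt, he'nd, -, hN'⟩ := exists_cubeRootWeilPairing W'
  rcases symplectic_or_antisymplectic W W' he3 hel her healt hend he'3 he'l he'r he'alt he'nd θ with
    h | h
  · exact Or.inl (exists_Δ_eq_cube_mul_Δ_of_symplectic W W' hN hN' θ hθ h)
  · exact Or.inr (exists_Δ_mul_Δ_eq_cube_of_antisymplectic W W' hN hN' θ hθ h)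

/-- **NO-GO.** If neither `Δ_E/Δ_{E′}` nor `Δ_EΔ_{E′}` is a cube in `K` (displayed as `h₁`, `h₂`),
there is NO `Γ_K`-equivariant additive isomorphism `E′[3] ≅ E[3]`: `E`, `E′` are not `3`-congruent
over `K`. [folklore] -/
theorem not_threeCongruent_of_forall_ne_cube (h₁ : ∀ c : K, W.Δ ≠ c ^ 3 * W'.Δ)
    (h₂ : ∀ c : K, W.Δ * W'.Δ ≠ c ^ 3) :
    ¬ ∃ θ : geomTorsion W' 3 ≃+ geomTorsion W 3,
      ∀ (σ : Field.absoluteGaloisGroup K) (P : geomTorsion W' 3), θ (σ • P) = σ • θ P := by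
  rintro ⟨θ, hθ⟩
  rcases Δ_eq_cube_mul_or_mul_eq_cube_of_threeCongruent W W' θ hθ with ⟨c, hc⟩ | ⟨c, hc⟩
  · exact h₁ c hc
  · exact h₂ c hc

/-- **`Δ_EΔ_{E′} ∉ K³` ⇒ every `3`-congruence is SYMPLECTIC for the cube-root pairings** (`hΔ`
displayed; Weil-type `e, e′` normalised by (N)). [folklore] -/
theorem symplectic_of_forall_mul_ne_cube
    {e : geomTorsion W 3 → geomTorsion W 3 → AlgebraicClosure K}
    {e' : geomTorsion W' 3 → geomTorsion W' 3 → AlgebraicClosure K}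
    (he3 : ∀ S T, e S T ^ 3 = 1) (hel : ∀ S₁ S₂ T, e (S₁ + S₂) T = e S₁ T * e S₂ T)
    (her : ∀ S T₁ T₂, e S (T₁ + T₂) = e S T₁ * e S T₂) (healt : ∀ T, e T T = 1)
    (hend : ∀ T, (∀ S, e S T = 1) → T = 0)
    (he'3 : ∀ S T, e' S T ^ 3 = 1) (he'l : ∀ S₁ S₂ T, e' (S₁ + S₂) T = e' S₁ T * e' S₂ T)
    (he'r : ∀ S T₁ T₂, e' S (T₁ + T₂) = e' S T₁ * e' S T₂) (he'alt : ∀ T, e' T T = 1)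
    (he'nd : ∀ T, (∀ S, e' S T = 1) → T = 0)
    (hN : ∀ S T : geomTorsion W 3, (S : geomPoints W) ≠ 0 → (T : geomPoints W) ≠ 0 →
        ((S + T : geomTorsion W 3) : geomPoints W) ≠ 0 →
        ((S - T : geomTorsion W 3) : geomPoints W) ≠ 0 →
        e S T * ((W.baseChange (AlgebraicClosure K)).b₄ -
          3 * (xOf (W := W.baseChange (AlgebraicClosure K)) ((S : geomTorsion W 3) : geomPoints W) *
              xOf (W := W.baseChange (AlgebraicClosure K)) ((T : geomTorsion W 3) : geomPoints W) +
            xOf (W := W.baseChange (AlgebraicClosure K)) ((S + T : geomTorsion W 3) : geomPoints W) *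
              xOf (W := W.baseChange (AlgebraicClosure K)) ((S - T : geomTorsion W 3) : geomPoints W))) =
          ((W.baseChange (AlgebraicClosure K)).b₄ -
          3 * (xOf (W := W.baseChange (AlgebraicClosure K)) ((S : geomTorsion W 3) : geomPoints W) *
              xOf (W := W.baseChange (AlgebraicClosure K)) ((S + T : geomTorsion W 3) : geomPoints W) +
            xOf (W := W.baseChange (AlgebraicClosure K)) ((T : geomTorsion W 3) : geomPoints W) *
              xOf (W := W.baseChange (AlgebraicClosure K)) ((S - T : geomTorsion W 3) : geomPoints W))))
    (hN' : ∀ S T : geomTorsion W' 3, (S : geomPoints W') ≠ 0 → (T : geomPoints W') ≠ 0 →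
        ((S + T : geomTorsion W' 3) : geomPoints W') ≠ 0 →
        ((S - T : geomTorsion W' 3) : geomPoints W') ≠ 0 →
        e' S T * ((W'.baseChange (AlgebraicClosure K)).b₄ -
          3 * (xOf (W := W'.baseChange (AlgebraicClosure K)) ((S : geomTorsion W' 3) : geomPoints W') *
              xOf (W := W'.baseChange (AlgebraicClosure K)) ((T : geomTorsion W' 3) : geomPoints W') +
            xOf (W := W'.baseChange (AlgebraicClosure K)) ((S + T : geomTorsion W' 3) : geomPoints W') *
              xOf (W := W'.baseChange (AlgebraicClosure K)) ((S - T : geomTorsion W' 3) : geomPoints W'))) =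
          ((W'.baseChange (AlgebraicClosure K)).b₄ -
          3 * (xOf (W := W'.baseChange (AlgebraicClosure K)) ((S : geomTorsion W' 3) : geomPoints W') *
              xOf (W := W'.baseChange (AlgebraicClosure K)) ((S + T : geomTorsion W' 3) : geomPoints W') +
            xOf (W := W'.baseChange (AlgebraicClosure K)) ((T : geomTorsion W' 3) : geomPoints W') *
              xOf (W := W'.baseChange (AlgebraicClosure K)) ((S - T : geomTorsion W' 3) : geomPoints W'))))
    (θ : geomTorsion W' 3 ≃+ geomTorsion W 3)
    (hθ : ∀ (σ : Field.absoluteGaloisGroup K) (P : geomTorsion W' 3), θ (σ • P) = σ • θ P)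
    (hΔ : ∀ c : K, W.Δ * W'.Δ ≠ c ^ 3) (S T : geomTorsion W' 3) : e (θ S) (θ T) = e' S T := by
  rcases symplectic_or_antisymplectic W W' he3 hel her healt hend he'3 he'l he'r he'alt he'nd θ with
    h | h
  · exact h S T
  · obtain ⟨c, hc⟩ := exists_Δ_mul_Δ_eq_cube_of_antisymplectic W W' hN hN' θ hθ h
    exact absurd hc (hΔ c)

/-- **`Δ_E ∉ Δ_{E′}K³` ⇒ every `3`-congruence is ANTI-SYMPLECTIC for the cube-root pairings**
(`hΔ` displayed). [folklore] -/
theorem antisymplectic_of_forall_ne_cube_mul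
    {e : geomTorsion W 3 → geomTorsion W 3 → AlgebraicClosure K}
    {e' : geomTorsion W' 3 → geomTorsion W' 3 → AlgebraicClosure K}
    (he3 : ∀ S T, e S T ^ 3 = 1) (hel : ∀ S₁ S₂ T, e (S₁ + S₂) T = e S₁ T * e S₂ T)
    (her : ∀ S T₁ T₂, e S (T₁ + T₂) = e S T₁ * e S T₂) (healt : ∀ T, e T T = 1)
    (hend : ∀ T, (∀ S, e S T = 1) → T = 0)
    (he'3 : ∀ S T, e' S T ^ 3 = 1) (he'l : ∀ S₁ S₂ T, e' (S₁ + S₂) T = e' S₁ T * e' S₂ T)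
    (he'r : ∀ S T₁ T₂, e' S (T₁ + T₂) = e' S T₁ * e' S T₂) (he'alt : ∀ T, e' T T = 1)
    (he'nd : ∀ T, (∀ S, e' S T = 1) → T = 0)
    (hN : ∀ S T : geomTorsion W 3, (S : geomPoints W) ≠ 0 → (T : geomPoints W) ≠ 0 →
        ((S + T : geomTorsion W 3) : geomPoints W) ≠ 0 →
        ((S - T : geomTorsion W 3) : geomPoints W) ≠ 0 →
        e S T * ((W.baseChange (AlgebraicClosure K)).b₄ -
          3 * (xOf (W := W.baseChange (AlgebraicClosure K)) ((S : geomTorsion W 3) : geomPoints W) *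
              xOf (W := W.baseChange (AlgebraicClosure K)) ((T : geomTorsion W 3) : geomPoints W) +
            xOf (W := W.baseChange (AlgebraicClosure K)) ((S + T : geomTorsion W 3) : geomPoints W) *
              xOf (W := W.baseChange (AlgebraicClosure K)) ((S - T : geomTorsion W 3) : geomPoints W))) =
          ((W.baseChange (AlgebraicClosure K)).b₄ -
          3 * (xOf (W := W.baseChange (AlgebraicClosure K)) ((S : geomTorsion W 3) : geomPoints W) *
              xOf (W := W.baseChange (AlgebraicClosure K)) ((S + T : geomTorsion W 3) : geomPoints W) +
            xOf (W := W.baseChange (AlgebraicClosure K)) ((T : geomTorsion W 3) : geomPoints W) *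
              xOf (W := W.baseChange (AlgebraicClosure K)) ((S - T : geomTorsion W 3) : geomPoints W))))
    (hN' : ∀ S T : geomTorsion W' 3, (S : geomPoints W') ≠ 0 → (T : geomPoints W') ≠ 0 →
        ((S + T : geomTorsion W' 3) : geomPoints W') ≠ 0 →
        ((S - T : geomTorsion W' 3) : geomPoints W') ≠ 0 →
        e' S T * ((W'.baseChange (AlgebraicClosure K)).b₄ -
          3 * (xOf (W := W'.baseChange (AlgebraicClosure K)) ((S : geomTorsion W' 3) : geomPoints W') *
              xOf (W := W'.baseChange (AlgebraicClosure K)) ((T : geomTorsion W' 3) : geomPoints W') +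
            xOf (W := W'.baseChange (AlgebraicClosure K)) ((S + T : geomTorsion W' 3) : geomPoints W') *
              xOf (W := W'.baseChange (AlgebraicClosure K)) ((S - T : geomTorsion W' 3) : geomPoints W'))) =
          ((W'.baseChange (AlgebraicClosure K)).b₄ -
          3 * (xOf (W := W'.baseChange (AlgebraicClosure K)) ((S : geomTorsion W' 3) : geomPoints W') *
              xOf (W := W'.baseChange (AlgebraicClosure K)) ((S + T : geomTorsion W' 3) : geomPoints W') +
            xOf (W := W'.baseChange (AlgebraicClosure K)) ((T : geomTorsion W' 3) : geomPoints W') *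
              xOf (W := W'.baseChange (AlgebraicClosure K)) ((S - T : geomTorsion W' 3) : geomPoints W'))))
    (θ : geomTorsion W' 3 ≃+ geomTorsion W 3)
    (hθ : ∀ (σ : Field.absoluteGaloisGroup K) (P : geomTorsion W' 3), θ (σ • P) = σ • θ P)
    (hΔ : ∀ c : K, W.Δ ≠ c ^ 3 * W'.Δ) (S T : geomTorsion W' 3) : e (θ S) (θ T) = (e' S T)⁻¹ := by
  rcases symplectic_or_antisymplectic W W' he3 hel her healt hend he'3 he'l he'r he'alt he'nd θ with
    h | h
  · obtain ⟨c, hc⟩ := exists_Δ_eq_cube_mul_Δ_of_symplectic W W' hN hN' θ hθ h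
    exact absurd hc (hΔ c)
  · exact h S T

end CubeLaw

end Summit.BirchSwinnertonDyer.Rank1Residual.GaloisImage.CubeRootPairing

end
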